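import Literature.MathematicalPhysics.QuantumFieldTheory.BalabanImbrieJaffe1984to88.BIJ88TruncatedExpectation5142
import Literature.Probability.LatticeModels.UrsellExplicitFormula

/-!
# `Balaban1983to89.B3TwoPointPerturbativeCoefficients` — T. Bałaban, *(Higgs)₂,₃ quantum fields in a finite volume.
# III. Renormalization*, Commun. Math. Phys. **88** (1983) 411–445 [Balaban1983Higgs3], p. 416: «The function G^ε has
# a perturbative expansion …» — THE COEFFICIENT STRUCTURE OF THAT EXPANSION TO ALL ORDERS, BEFORE WICK'S THEOREM:
# the `t`-derivatives of a Gibbs expectation `⟨F e^{−tV}⟩/⟨e^{−tV}⟩` are the truncated expectations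
# `⟨F; −V; …; −V⟩ᵀ_t` (pinned exponential formula), one-sided on `[0, ∞)`, with Taylor's formula at `t = 0⁺`

statement-level skeleton of published theorems with citation tags; proofs where landed; nothing here is a claim about
the Yang–Mills mass gap

CITATION HEADER (lean-in-tree rule).  Part of the lit-balaban TYPED SKELETON (HOME `run/shared/lean/pub/lit-balaban/`),
Phase 2, proof seat p33 (gen 70, unit `lit-balaban-p33`); row **B3.Eq1.19-1.22** of `HOME/lit-balaban-r15/ROWS-B3.md`
(fold owner r15; head `proved` under the lead's HEAD WORD Q25, 2026-08-23 — this file is an OPTIONAL located member of the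
(1.19)/(1.21) cell, zero head weight: BRICK 4 of the target `B3TwoPointPerturbativeExpansion` named in r15's HEAD QUESTION 25,
disjoint from BRICK 1 `B3Eq122FirstOrderWick` (p39), BRICK 2 `B3Eq121OnePIChains` (p32), BRICK 3 `B3OnePIGraphs` (p37)).
The (1.19) instance (the typer's CONCRETE `B3Sect1TwoPoint.twoPoint` as the `t = 1` value of the vertex-weighted family,
with the hypotheses of §2 discharged on the `(Higgs)₂,₃` carrier) is the sibling file `B3Eq119VertexExpansion`.

THE PRINT (p. 416 = PDF 6 of the held text `paper:balaban1983-higgs-2-3-quantum-fields-finite-volume`, L4–18, re-read this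
session; the ×2 render `pub-balaban/b2b-balaban-ref1/pages/1983-cmp88-higgs23-III/…-p006-x2.png` is the lead's/owner's
reading of record): «Let us begin with the mass renormalization counterterm δm². It is determined by the two-point Schwinger
function G^ε_{ab}(x, x′) = ⟨φ_a(x)φ_b(x′)⟩^ε = (Z^ε)^{−1}∫dA∫dφ e^{−S^ε(A,φ)}φ_a(x)φ_b(x′), x, x′ ∈ T_ε, (1.19) where
S^ε(A, φ) is the lattice action of the model given by (1.20) and Z^ε is the partition function. The function G^ε has a
perturbative expansion of the following structure G^ε = Σ_{n=0}^∞ C^ε_0[(−δm² + Σ^ε + ∂^{ε*}Σ^ε_1 + Σ^{ε*}_1∂^ε +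
∂^{ε*}Σ^ε_2∂^ε)C^ε_0]ⁿ, (1.21) where C^ε_0 = (−Δ^ε_0 + m²)^{−1} and Σ^ε, Σ^ε_1, Σ^ε_2 are given by amputated,
one-particle-irreducible graphs of the expansion of G^ε. Here we have a graphical description of the same type as in (1.17),
but with some simplifications. We have η = ε (hence L^kε = 1) and the only vertices are (1.6), (1.7) [with δm² instead of
δm_i²(x)], (1.8), and (1.10) with n′ = 0, B̃ = 0, g_k = 1».

WHAT «HAS A PERTURBATIVE EXPANSION» MEANS AT THE LEVEL OF COEFFICIENTS, AND WHAT IS PROVED HERE (0 `sorry`, no `Prop`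
fact; standard axioms).  Write the interacting expectation as `g(t) = N(t)/Z(t)`, `N(t) = ∫ F e^{−tV} dν`,
`Z(t) = ∫ e^{−tV} dν` (`ν` the unperturbed measure, `V` the sum of the vertices, `F` the observable; (1.19) is `g(1)`).  The
perturbative coefficients are the `t`-derivatives of `g` at `t = 0⁺`; the classical fact used by print (formal perturbation
theory, «the expansion of G^ε» into graphs with the disconnected vacuum parts cancelled against `Z^ε`) is, before any
Wick/graph evaluation: `g^{(n)}(t) = ⟨F; −V; …; −V⟩ᵀ_t`, the TRUNCATED (connected, Ursell) expectation of the tilted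
measure with the observable pinned and `n` insertions of `−V` [Mastropietro2008, §2.3 (2.32)–(2.38); Ruelle1969 §4.4.1].
* §1 (calculus + `Literature.Probability.LatticeModels.ursellOf`) THE PINNED EXPONENTIAL FORMULA: for `z > 0` and `w` of
  class `Cⁿ` within a set `s` of unique differentiability and `t ∈ s`, `(w/z)^{(|W|)}(t)` IS the Ursell function, evaluated
  on `W ∪ {pin}`, of the PINNED DERIVATIVE MOMENTS `K ↦ w^{(|K|−1)}(t)/z(t)` (`pin ∈ K`), `K ↦ z^{(|K|)}(t)/z(t)`
  (`pin ∉ K`) — `iteratedDerivWithin_div_eq_ursellOf`, with the explicit Möbius form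
  `iteratedDerivWithin_div_eq_sum_setPartitions`; the pin-free blocks are p36's exponential formula
  `BIJ88TruncatedExpectation5142.iteratedDerivWithin_eq_mul_sum_setPartitions` ((log z)^{(n)}, by name), the pinned block
  decomposition is the Leibniz rule for `w = (w/z)·z` in powerset form (`iteratedDerivWithin_eq_sum_powerset`), uniqueness is
  p36's `trunc_unique`.
* §2 ([folklore], abstract measure `ν`, hypotheses `TiltData`: `F`, `V` a.e.-strongly measurable, `V` bounded below, all
  products `F·V^k` integrable) THE TILTED MOMENTS `N_k(t) = ∫ F(−V)^k e^{−tV} dν` are `C^∞` on `Set.Ici 0` with `N_{k+1}`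
  the RIGHT derivative of `N_k` (`TiltData.hasDerivWithinAt_tiltMoment`, dominated convergence with the bound
  `e^{(t₀+1)B}|F||V|^{k+1}`; the typer's `B1Eq113OneSidedDerivatives.hasDerivWithinAt_momentFn` is the template),
  `TiltData.contDiffOn_tiltMoment`, `TiltData.iteratedDerivWithin_tiltMoment`.
* §3 THE COEFFICIENTS: `g = N^F_0/N^1_0` is `C^∞` on `[0, ∞)` (`TiltData.contDiffOn_tiltExpect`; `Z > 0` by
  `integral_exp_pos`) and **`iteratedDerivWithin |W| g (Ici 0) t = ursellOf (pinned normalized tilted moments) (insert pin W)`**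
  (`TiltData.iteratedDerivWithin_tiltExpect_eq_ursellOf`, `…_fin` with `n` insertions labelled by `Fin n`, explicit Möbius
  form `…_eq_sum_setPartitions`, first order `TiltData.derivWithin_tiltExpect` = `⟨F(−V)⟩_t − ⟨F⟩_t⟨−V⟩_t`), and
  **Taylor's formula at `0⁺` with Lagrange remainder** `TiltData.taylor_tiltExpect`:
  `g(t) = Σ_{k≤n} g^{(k)}(0⁺)t^k/k! + g^{(n+1)}(ξ)t^{n+1}/(n+1)!`, `ξ ∈ (0, t)` (Mathlib's `taylor_mean_remainder_lagrange`
  on `[0, t]`, the within-`[0,t]` derivatives transported to within-`[0,∞)` ones, `iteratedDerivWithin_congr_set`).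
HONEST SCOPE.  (i) Nothing here is specific to the `(Higgs)₂,₃` model — the instance is the sibling file; (ii) the
coefficients are identified as truncated expectations, NOT as sums of Feynman graphs (Wick's theorem at general order is p39's
`GaussianWick`/`B3GaussianContractions` lane) and no Dyson/1PI resummation is performed (p32/p37's bricks); (iii) all
derivatives are ONE-SIDED at `t = 0` (within `Set.Ici 0`), as they must be when `e^{+tV}` is not integrable (cf. the typer's
finding `B1Eq113OneSidedDerivatives` on (I.1.13)); (iv) «perturbative expansion» is rendered as Taylor's formula with
remainder to every finite order — no statement about convergence or about `ε → 0` is made.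
-/

open Finset MeasureTheory Filter Topology
open scoped ContDiff
open Literature.Probability.LatticeModels (setPartitions mem_setPartitions sum_setPartitions_eq_sum_block ursellOf
  sum_setPartitions_prod_ursellOf ursellOf_eq_sum_setPartitions ursellOf_pair setPartitions_empty isSetPartition_singleton)
open Literature.MathematicalPhysics.QuantumFieldTheory.BalabanImbrieJaffe1984to88.BIJ88TruncatedExpectation5142
  (iteratedDerivWithin_eq_mul_sum_setPartitions trunc_unique sum_powerset_filter_mem_eq)

namespace Literature.MathematicalPhysics.QuantumFieldTheory.Balaban1983to89.B3TwoPointPerturbativeCoefficients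

/-! ## §1 The pinned exponential formula: `(w/z)^{(n)}` as a pinned Ursell function of the derivative moments -/

section Pinned

variable {β : Type*} [DecidableEq β]

/-- The PINNED DERIVATIVE MOMENTS of a pair `(w, z)` at `t` within `s`, pin `j`: `K ↦ w^{(|K|−1)}(t)/z(t)` if `j ∈ K`,
`K ↦ z^{(|K|)}(t)/z(t)` if `j ∉ K` — for `w = ∫Fe^{−tV}`, `z = ∫e^{−tV}` these are the normalized tilted expectations
`⟨F(−V)^{|K|−1}⟩_t`, `⟨(−V)^{|K|}⟩_t` (§3). [folklore] [cite: Mastropietro2008, §2.3 (2.32)-(2.38)] -/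
noncomputable def pinnedMoments (j : β) (w z : ℝ → ℝ) (s : Set ℝ) (t : ℝ) (K : Finset β) : ℝ :=
  if j ∈ K then iteratedDerivWithin (K.card - 1) w s t / z t else iteratedDerivWithin K.card z s t / z t

/-- The candidate truncated functions: `(w/z)^{(|K|−1)}(t)` on blocks containing the pin, `(log z)^{(|K|)}(t)` on the others.
[folklore] [cite: Mastropietro2008, §2.3 (2.32)-(2.38)] -/
noncomputable def pinnedTrunc (j : β) (w z : ℝ → ℝ) (s : Set ℝ) (t : ℝ) (K : Finset β) : ℝ :=
  if j ∈ K then iteratedDerivWithin (K.card - 1) (fun x => w x / z x) s t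
  else iteratedDerivWithin K.card (fun x => Real.log (z x)) s t

/-- The pinned moments are normalized: value `1` on `∅`. [folklore] [cite: Mastropietro2008, §2.3 (2.36)-(2.38)] -/
theorem pinnedMoments_empty (j : β) (w z : ℝ → ℝ) (s : Set ℝ) {t : ℝ} (ht : z t ≠ 0) :
    pinnedMoments j w z s t ∅ = 1 := by
  simp [pinnedMoments, ht]

variable {s : Set ℝ} {t : ℝ} {z w : ℝ → ℝ} {n : ℕ}

omit [DecidableEq β] in
/-- The Leibniz rule for `w = (w/z)·z` in POWERSET form: `w^{(|K|)}(t) = Σ_{P ⊆ K} (w/z)^{(|P|)}(t)·z^{(|K|−|P|)}(t)`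
(`z > 0`, `w`, `z` of class `Cⁿ` within `s`, `|K| ≤ n`; Mathlib's `iteratedDerivWithin_mul` + `Finset.sum_powerset_apply_card`).
[folklore] [cite: Mastropietro2008, §2.3 (2.36)-(2.38)] -/
theorem iteratedDerivWithin_eq_sum_powerset (hs : UniqueDiffOn ℝ s) (ht : t ∈ s)
    (hz : ContDiffOn ℝ n z s) (hw : ContDiffOn ℝ n w s) (hpos : ∀ x ∈ s, 0 < z x)
    (K : Finset β) (hK : K.card ≤ n) :
    iteratedDerivWithin K.card w s t
      = ∑ P ∈ K.powerset, iteratedDerivWithin P.card (fun x => w x / z x) s t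
          * iteratedDerivWithin (K.card - P.card) z s t := by
  have hne : ∀ x ∈ s, z x ≠ 0 := fun x hx => (hpos x hx).ne'
  have hg : ContDiffOn ℝ n (fun x => w x / z x) s := hw.div hz hne
  have hcongr : Set.EqOn w ((fun x => w x / z x) * z) s := by
    intro x hx
    simp only [Pi.mul_apply]
    rw [div_mul_cancel₀ _ (hne x hx)]
  have hgK : ContDiffWithinAt ℝ (K.card : ℕ) (fun x => w x / z x) s t :=
    (hg t ht).of_le (by exact_mod_cast hK)
  have hzK : ContDiffWithinAt ℝ (K.card : ℕ) z s t := (hz t ht).of_le (by exact_mod_cast hK)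
  rw [iteratedDerivWithin_congr (n := K.card) hcongr ht, iteratedDerivWithin_mul ht hs hgK hzK,
    Finset.sum_powerset_apply_card
      (fun i => iteratedDerivWithin i (fun x => w x / z x) s t * iteratedDerivWithin (K.card - i) z s t)]
  refine sum_congr rfl fun i _ => ?_
  rw [nsmul_eq_mul, mul_assoc]

/-- The cluster relation on a set AVOIDING the pin: `Σ_{π∈𝒫(K)} Π_{B∈π} (log z)^{(|B|)}(t) = z^{(|K|)}(t)/z(t)` — p36's
exponential formula `BIJ88TruncatedExpectation5142.iteratedDerivWithin_eq_mul_sum_setPartitions`, by name. [folklore]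
[cite: Mastropietro2008, §2.3 (2.36)-(2.38)] -/
theorem sum_prod_pinnedTrunc_of_not_mem (hs : UniqueDiffOn ℝ s) (ht : t ∈ s)
    (hz : ContDiffOn ℝ n z s) (hpos : ∀ x ∈ s, 0 < z x) (j : β) (w : ℝ → ℝ)
    {K : Finset β} (hjK : j ∉ K) (hK : K.card ≤ n) :
    ∑ π ∈ setPartitions K, ∏ B ∈ π, pinnedTrunc j w z s t B = pinnedMoments j w z s t K := by
  have hzt : z t ≠ 0 := (hpos t ht).ne'
  have hblocks : ∀ π ∈ setPartitions K, ∏ B ∈ π, pinnedTrunc j w z s t B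
      = ∏ B ∈ π, iteratedDerivWithin B.card (fun x => Real.log (z x)) s t := by
    intro π hπ
    refine prod_congr rfl fun B hB => ?_
    have hBK : B ⊆ K := (mem_setPartitions.1 hπ).subset hB
    have hjB : j ∉ B := fun h => hjK (hBK h)
    simp [pinnedTrunc, hjB]
  rw [sum_congr rfl hblocks, pinnedMoments, if_neg hjK,
    iteratedDerivWithin_eq_mul_sum_setPartitions hs ht hz hpos K hK, mul_div_cancel_left₀ _ hzt]

/-- The cluster relation on a set CONTAINING the pin: `Σ_{π∈𝒫(K)} Π_{B∈π} (pinned candidate)(B) = w^{(|K|−1)}(t)/z(t)` —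
the block decomposition at the pin (`LatticeModels.sum_setPartitions_eq_sum_block`), the pin-free inner sums by the
exponential formula, and the Leibniz rule in powerset form. [folklore] [cite: Mastropietro2008, §2.3 (2.36)-(2.38)] -/
theorem sum_prod_pinnedTrunc_of_mem (hs : UniqueDiffOn ℝ s) (ht : t ∈ s)
    (hz : ContDiffOn ℝ n z s) (hw : ContDiffOn ℝ n w s) (hpos : ∀ x ∈ s, 0 < z x) (j : β)
    {K : Finset β} (hjK : j ∈ K) (hK : (K.erase j).card ≤ n) :
    ∑ π ∈ setPartitions K, ∏ B ∈ π, pinnedTrunc j w z s t B = pinnedMoments j w z s t K := by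
  have hzt : z t ≠ 0 := (hpos t ht).ne'
  rw [sum_setPartitions_eq_sum_block hjK]
  -- inner sums: blocks of `K \ P₀` avoid `j`
  have hinner : ∀ P₀ ∈ K.powerset.filter (fun P => j ∈ P),
      ∑ ρ ∈ setPartitions (K \ P₀), ∏ B ∈ insert P₀ ρ, pinnedTrunc j w z s t B
        = iteratedDerivWithin (P₀.card - 1) (fun x => w x / z x) s t
            * (iteratedDerivWithin (K \ P₀).card z s t / z t) := by
    intro P₀ hP₀
    simp only [mem_filter, mem_powerset] at hP₀
    have hjC : j ∉ K \ P₀ := fun h => (mem_sdiff.1 h).2 hP₀.2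
    have hcard : (K \ P₀).card ≤ n := by
      refine le_trans (card_le_card ?_) hK
      intro x hx
      rw [Finset.mem_sdiff] at hx
      exact Finset.mem_erase.2 ⟨fun h => hjC (h ▸ Finset.mem_sdiff.2 hx), hx.1⟩
    have hprod : ∀ ρ ∈ setPartitions (K \ P₀), ∏ B ∈ insert P₀ ρ, pinnedTrunc j w z s t B
        = iteratedDerivWithin (P₀.card - 1) (fun x => w x / z x) s t
            * ∏ B ∈ ρ, pinnedTrunc j w z s t B := by
      intro ρ hρ
      rw [prod_insert ((mem_setPartitions.1 hρ).notMem_of_sdiff ⟨j, hP₀.2⟩)]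
      simp [pinnedTrunc, hP₀.2]
    rw [sum_congr rfl hprod, ← mul_sum, sum_prod_pinnedTrunc_of_not_mem hs ht hz hpos j w hjC hcard,
      pinnedMoments, if_neg hjC]
  rw [sum_congr rfl hinner, sum_powerset_filter_mem_eq hjK]
  -- the summand depends on `P` through `|P|`
  have hcardK : (K.erase j).card + 1 = K.card := card_erase_add_one hjK
  have hsummand : ∀ P ∈ (K.erase j).powerset,
      iteratedDerivWithin ((insert j P).card - 1) (fun x => w x / z x) s t
          * (iteratedDerivWithin (K \ insert j P).card z s t / z t)
        = (iteratedDerivWithin P.card (fun x => w x / z x) s t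
            * iteratedDerivWithin ((K.erase j).card - P.card) z s t) / z t := by
    intro P hP
    rw [mem_powerset] at hP
    have hjP : j ∉ P := fun h => notMem_erase j K (hP h)
    have hPK : insert j P ⊆ K := insert_subset hjK (hP.trans (erase_subset j K))
    rw [card_insert_of_notMem hjP, Nat.add_sub_cancel, card_sdiff_of_subset hPK, card_insert_of_notMem hjP,
      mul_div_assoc]
    congr 3
    omega
  rw [sum_congr rfl hsummand, ← sum_div,
    ← iteratedDerivWithin_eq_sum_powerset hs ht hz hw hpos (K.erase j) hK, pinnedMoments, if_pos hjK]
  congr 2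
  omega

/-- On every nonempty `K ⊆ W ∪ {pin}` (`|W| ≤ n`) the candidate truncated functions ARE the Ursell functions of the pinned
derivative moments (uniqueness of the Möbius inversion, p36's `trunc_unique`). [folklore] [cite: Mastropietro2008, §2.3 (2.36)-(2.38)] -/
theorem pinnedTrunc_eq_ursellOf (hs : UniqueDiffOn ℝ s) (ht : t ∈ s)
    (hz : ContDiffOn ℝ n z s) (hw : ContDiffOn ℝ n w s) (hpos : ∀ x ∈ s, 0 < z x) (j : β)
    {W : Finset β} (hW : W.card ≤ n) :
    ∀ K ⊆ insert j W, K.Nonempty → pinnedTrunc j w z s t K = ursellOf (pinnedMoments j w z s t) K := by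
  refine trunc_unique (V := insert j W) (m := pinnedMoments j w z s t) ?_ ?_
  · intro K hKV _
    by_cases hjK : j ∈ K
    · refine (sum_prod_pinnedTrunc_of_mem hs ht hz hw hpos j hjK ?_).symm
      refine le_trans (card_le_card fun x hx => ?_) hW
      obtain ⟨hxj, hxK⟩ := mem_erase.1 hx
      exact mem_of_mem_insert_of_ne (hKV hxK) hxj
    · refine (sum_prod_pinnedTrunc_of_not_mem hs ht hz hpos j w hjK ?_).symm
      refine le_trans (card_le_card fun x hx => ?_) hW
      exact mem_of_mem_insert_of_ne (hKV hx) (fun h => hjK (h ▸ hx))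
  · intro K _ hK
    exact (sum_setPartitions_prod_ursellOf _ hK).symm

/-- **THE PINNED EXPONENTIAL FORMULA.** For `z > 0` and `w` of class `Cⁿ` within a set `s` of unique differentiability,
`t ∈ s`, a pin `j ∉ W`, `|W| ≤ n`: `(w/z)^{(|W|)}(t) = ursellOf (pinnedMoments j w z s t) (insert j W)` — the `|W|`-th
derivative of the quotient is the truncated function, pinned at the numerator, of the derivative moments (the quotient
analogue of Faà di Bruno's formula for `log z`, which is the pin-free case). [folklore] [cite: Mastropietro2008, §2.3 (2.32)-(2.38)] -/
theorem iteratedDerivWithin_div_eq_ursellOf (hs : UniqueDiffOn ℝ s) (ht : t ∈ s)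
    (hz : ContDiffOn ℝ n z s) (hw : ContDiffOn ℝ n w s) (hpos : ∀ x ∈ s, 0 < z x) {j : β}
    {W : Finset β} (hjW : j ∉ W) (hW : W.card ≤ n) :
    iteratedDerivWithin W.card (fun x => w x / z x) s t
      = ursellOf (pinnedMoments j w z s t) (insert j W) := by
  have h := pinnedTrunc_eq_ursellOf hs ht hz hw hpos j hW (insert j W) Finset.Subset.rfl (insert_nonempty j W)
  rw [pinnedTrunc, if_pos (mem_insert_self j W), card_insert_of_notMem hjW, Nat.add_sub_cancel] at h
  exact h

/-- The same in explicit Möbius form: `(w/z)^{(|W|)}(t) = Σ_{π∈𝒫(W∪{j})} (−1)^{|π|−1}(|π|−1)! Π_{B∈π} (pinned moment)(B)`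
(`LatticeModels.ursellOf_eq_sum_setPartitions`). [folklore] [cite: Ruelle1969, §4.4.1 (4.6)] -/
theorem iteratedDerivWithin_div_eq_sum_setPartitions (hs : UniqueDiffOn ℝ s) (ht : t ∈ s)
    (hz : ContDiffOn ℝ n z s) (hw : ContDiffOn ℝ n w s) (hpos : ∀ x ∈ s, 0 < z x) {j : β}
    {W : Finset β} (hjW : j ∉ W) (hW : W.card ≤ n) :
    iteratedDerivWithin W.card (fun x => w x / z x) s t
      = ∑ π ∈ setPartitions (insert j W),
          (-1 : ℝ) ^ (π.card - 1) * ((π.card - 1).factorial : ℝ) * ∏ P ∈ π, pinnedMoments j w z s t P := by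
  rw [iteratedDerivWithin_div_eq_ursellOf hs ht hz hw hpos hjW hW,
    ursellOf_eq_sum_setPartitions _ (pinnedMoments_empty j w z s (hpos t ht).ne') (insert_nonempty j W)]

end Pinned


/-! ## §2 Tilted moments `∫ F(−V)^k e^{−tV} dν`: one-sided smoothness on `[0, ∞)` by dominated convergence -/

section Tilted

open Set

variable {Ω : Type*} [MeasurableSpace Ω]

/-- The TILTED MOMENTS `N_k(t) = ∫ F·(−V)^k·e^{−tV} dν` of an observable `F` against the interaction `V` (`N_0 = ∫Fe^{−tV}`;
with `F = 1`, `N_0 = Z(t)`). [folklore] [cite: Balaban1983Higgs3, (1.21) p.416] -/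
noncomputable def tiltMoment (ν : Measure Ω) (F V : Ω → ℝ) (k : ℕ) (t : ℝ) : ℝ :=
  ∫ σ, F σ * (-V σ) ^ k * Real.exp (-(t * V σ)) ∂ν

/-- The hypotheses of §2–§3 on `(ν, F, V)`: `F` and `V` a.e.-strongly measurable, `V` bounded below (`V ≥ −B`, `B ≥ 0`), and
every product `F·V^k` integrable (all «moments» exist — e.g. polynomial observables against a Gaussian-type weight). [folklore]
[cite: Balaban1983Higgs3, (1.21) p.416] -/
structure TiltData (ν : Measure Ω) (F V : Ω → ℝ) : Prop where
  aesm_F : AEStronglyMeasurable F ν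
  aesm_V : AEStronglyMeasurable V ν
  bddBelow : ∃ B : ℝ, 0 ≤ B ∧ ∀ σ, -B ≤ V σ
  integrable : ∀ k : ℕ, Integrable (fun σ => F σ * V σ ^ k) ν

/-- `|e^x − e^y| ≤ |x − y|·max(e^x, e^y)`. [folklore] -/
private theorem abs_exp_sub_exp_le (x y : ℝ) :
    |Real.exp x - Real.exp y| ≤ |x - y| * max (Real.exp x) (Real.exp y) := by
  have key : ∀ a b : ℝ, a ≤ b → Real.exp b - Real.exp a ≤ (b - a) * Real.exp b := by
    intro a b _
    have h1 := Real.add_one_le_exp (-(b - a))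
    have h2 : Real.exp b - Real.exp a = Real.exp a * (Real.exp (b - a) - 1) := by
      rw [mul_sub, mul_one, ← Real.exp_add]; congr 2; ring
    have h3 : Real.exp (b - a) - 1 ≤ (b - a) * Real.exp (b - a) := by
      have h4 : (-(b - a) + 1) * Real.exp (b - a) ≤ Real.exp (-(b - a)) * Real.exp (b - a) :=
        mul_le_mul_of_nonneg_right h1 (Real.exp_pos _).le
      rw [← Real.exp_add, neg_add_cancel, Real.exp_zero] at h4
      nlinarith
    calc Real.exp b - Real.exp a = Real.exp a * (Real.exp (b - a) - 1) := h2
      _ ≤ Real.exp a * ((b - a) * Real.exp (b - a)) := mul_le_mul_of_nonneg_left h3 (Real.exp_pos _).le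
      _ = (b - a) * Real.exp b := by rw [mul_left_comm, ← Real.exp_add]; congr 2; ring
  rcases le_total x y with hxy | hxy
  · have hmono : Real.exp x ≤ Real.exp y := Real.exp_le_exp.2 hxy
    rw [abs_sub_comm, abs_of_nonneg (sub_nonneg.2 hmono), abs_sub_comm, abs_of_nonneg (sub_nonneg.2 hxy),
      max_eq_right hmono]
    exact key x y hxy
  · have hmono : Real.exp y ≤ Real.exp x := Real.exp_le_exp.2 hxy
    rw [abs_of_nonneg (sub_nonneg.2 hmono), abs_of_nonneg (sub_nonneg.2 hxy), max_eq_left hmono]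
    exact key y x hxy

variable {ν : Measure Ω} {F V : Ω → ℝ}

/-- `|F|·|V|^k` is integrable. [folklore] [cite: Balaban1983Higgs3, (1.21) p.416] -/
theorem TiltData.integrable_abs (h : TiltData ν F V) (k : ℕ) :
    Integrable (fun σ => |F σ| * |V σ| ^ k) ν := by
  refine ((h.integrable k).abs).congr (Eventually.of_forall fun σ => ?_)
  simp [abs_mul, abs_pow]

/-- The integrand of `N_k(t)` is a.e.-strongly measurable. [folklore] [cite: Balaban1983Higgs3, (1.21) p.416] -/
theorem TiltData.aesm_integrand (h : TiltData ν F V) (k : ℕ) (t : ℝ) :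
    AEStronglyMeasurable (fun σ => F σ * (-V σ) ^ k * Real.exp (-(t * V σ))) ν :=
  (h.aesm_F.mul (h.aesm_V.neg.pow k)).mul
    (Real.continuous_exp.comp_aestronglyMeasurable (h.aesm_V.const_mul t).neg)

/-- For `t ≥ 0` the integrand of `N_k(t)` is integrable, dominated by `e^{tB}|F||V|^k`. [folklore] [cite: Balaban1983Higgs3, (1.21) p.416] -/
theorem TiltData.integrable_integrand (h : TiltData ν F V) (k : ℕ) {t : ℝ} (ht : 0 ≤ t) :
    Integrable (fun σ => F σ * (-V σ) ^ k * Real.exp (-(t * V σ))) ν := by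
  obtain ⟨B, hB0, hB⟩ := h.bddBelow
  refine ((h.integrable_abs k).const_mul (Real.exp (t * B))).mono' (h.aesm_integrand k t)
    (Eventually.of_forall fun σ => ?_)
  rw [Real.norm_eq_abs, abs_mul, abs_mul, abs_pow, abs_neg, abs_of_pos (Real.exp_pos _)]
  have hexp : Real.exp (-(t * V σ)) ≤ Real.exp (t * B) := by
    rw [Real.exp_le_exp]; nlinarith [hB σ]
  calc |F σ| * |V σ| ^ k * Real.exp (-(t * V σ)) ≤ |F σ| * |V σ| ^ k * Real.exp (t * B) :=
        mul_le_mul_of_nonneg_left hexp (by positivity)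
    _ = Real.exp (t * B) * (|F σ| * |V σ| ^ k) := by ring

/-- **`N_{k+1}` is the right derivative of `N_k` on `[0, ∞)`** (dominated convergence; the typer's
`B1Eq113OneSidedDerivatives.hasDerivWithinAt_momentFn` generalized to an observable and an abstract measure). [folklore]
[cite: Balaban1983Higgs3, (1.21) p.416] -/
theorem TiltData.hasDerivWithinAt_tiltMoment (h : TiltData ν F V) (k : ℕ) {t₀ : ℝ} (ht₀ : 0 ≤ t₀) :
    HasDerivWithinAt (tiltMoment ν F V k) (tiltMoment ν F V (k + 1) t₀) (Ici 0) t₀ := by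
  obtain ⟨B, hB0, hB⟩ := h.bddBelow
  rw [hasDerivWithinAt_iff_tendsto_slope]
  set G : ℝ → Ω → ℝ := fun t σ =>
    (t - t₀)⁻¹ * (F σ * (-V σ) ^ k * Real.exp (-(t * V σ)) - F σ * (-V σ) ^ k * Real.exp (-(t₀ * V σ)))
    with hG
  have hmem : ∀ᶠ t in 𝓝[Ici (0 : ℝ) \ {t₀}] t₀, (0 ≤ t ∧ t ≠ t₀) ∧ t < t₀ + 1 := by
    have h1 : ∀ᶠ t in 𝓝[Ici (0 : ℝ) \ {t₀}] t₀, 0 ≤ t ∧ t ≠ t₀ := by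
      filter_upwards [self_mem_nhdsWithin] with t ht
      exact ⟨ht.1, ht.2⟩
    have h2 : ∀ᶠ t in 𝓝[Ici (0 : ℝ) \ {t₀}] t₀, t < t₀ + 1 :=
      nhdsWithin_le_nhds (Iio_mem_nhds (by linarith))
    exact h1.and h2
  have key : ∀ t : ℝ, 0 ≤ t → t ≠ t₀ → slope (tiltMoment ν F V k) t₀ t = ∫ σ, G t σ ∂ν := by
    intro t ht hne
    rw [slope_def_field]
    unfold tiltMoment
    rw [← integral_sub (h.integrable_integrand k ht) (h.integrable_integrand k ht₀), div_eq_inv_mul,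
      ← integral_const_mul]
  have hmeas : ∀ᶠ t in 𝓝[Ici (0 : ℝ) \ {t₀}] t₀, AEStronglyMeasurable (G t) ν :=
    Eventually.of_forall fun t =>
      (((h.aesm_integrand k t).sub (h.aesm_integrand k t₀)).const_mul _)
  have hbound : ∀ᶠ t in 𝓝[Ici (0 : ℝ) \ {t₀}] t₀, ∀ᵐ σ ∂ν,
      ‖G t σ‖ ≤ Real.exp ((t₀ + 1) * B) * (|F σ| * |V σ| ^ (k + 1)) := by
    filter_upwards [hmem] with t ht
    refine Eventually.of_forall fun σ => ?_
    obtain ⟨⟨ht0, htne⟩, ht1⟩ := ht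
    have hne : t - t₀ ≠ 0 := sub_ne_zero.2 htne
    have hfac : F σ * (-V σ) ^ k * Real.exp (-(t * V σ)) - F σ * (-V σ) ^ k * Real.exp (-(t₀ * V σ))
        = F σ * (-V σ) ^ k * (Real.exp (-(t * V σ)) - Real.exp (-(t₀ * V σ))) := by ring
    have hlip := abs_exp_sub_exp_le (-(t * V σ)) (-(t₀ * V σ))
    have hmax : max (Real.exp (-(t * V σ))) (Real.exp (-(t₀ * V σ))) ≤ Real.exp ((t₀ + 1) * B) := by
      refine max_le ?_ ?_ <;> rw [Real.exp_le_exp] <;> nlinarith [hB σ]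
    have hdiff : |(-(t * V σ)) - (-(t₀ * V σ))| = |t - t₀| * |V σ| := by
      rw [show (-(t * V σ)) - (-(t₀ * V σ)) = -((t - t₀) * V σ) by ring, abs_neg, abs_mul]
    simp only [hG]
    rw [hfac, Real.norm_eq_abs, abs_mul, abs_mul, abs_mul, abs_inv, abs_pow, abs_neg]
    rw [hdiff] at hlip
    have hpos : 0 < |t - t₀| := abs_pos.2 hne
    calc |t - t₀|⁻¹ * (|F σ| * |V σ| ^ k * |Real.exp (-(t * V σ)) - Real.exp (-(t₀ * V σ))|)
        ≤ |t - t₀|⁻¹ * (|F σ| * |V σ| ^ k * (|t - t₀| * |V σ| * Real.exp ((t₀ + 1) * B))) := by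
          gcongr
          exact hlip.trans (mul_le_mul_of_nonneg_left hmax (by positivity))
      _ = Real.exp ((t₀ + 1) * B) * (|F σ| * |V σ| ^ (k + 1)) := by
          field_simp
          ring
  have hlim : ∀ᵐ σ ∂ν, Tendsto (fun t => G t σ) (𝓝[Ici (0 : ℝ) \ {t₀}] t₀)
      (𝓝 (F σ * (-V σ) ^ (k + 1) * Real.exp (-(t₀ * V σ)))) := by
    refine Eventually.of_forall fun σ => ?_
    have hd : HasDerivAt (fun t : ℝ => F σ * (-V σ) ^ k * Real.exp (-(t * V σ)))
        (F σ * (-V σ) ^ (k + 1) * Real.exp (-(t₀ * V σ))) t₀ := by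
      have h1 : HasDerivAt (fun t : ℝ => -(t * V σ)) (-(1 * V σ)) t₀ := ((hasDerivAt_id t₀).mul_const _).neg
      refine (h1.exp.const_mul (F σ * (-V σ) ^ k)).congr_deriv ?_
      rw [pow_succ]; ring
    have hmono : 𝓝[Ici (0 : ℝ) \ {t₀}] t₀ ≤ 𝓝[≠] t₀ := nhdsWithin_mono _ fun x hx => hx.2
    refine (hd.tendsto_slope.mono_left hmono).congr' ?_
    filter_upwards [hmem] with t ht
    rw [slope_def_field]
    simp only [hG, div_eq_inv_mul]
  have hT := tendsto_integral_filter_of_dominated_convergence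
    (fun σ => Real.exp ((t₀ + 1) * B) * (|F σ| * |V σ| ^ (k + 1))) hmeas hbound
    ((h.integrable_abs (k + 1)).const_mul _) hlim
  refine hT.congr' ?_
  filter_upwards [hmem] with t ht using (key t ht.1.1 ht.1.2).symm

/-- `derivWithin N_k [0,∞) = N_{k+1}` on `[0, ∞)`. [folklore] [cite: Balaban1983Higgs3, (1.21) p.416] -/
theorem TiltData.derivWithin_tiltMoment (h : TiltData ν F V) (k : ℕ) {t₀ : ℝ} (ht₀ : 0 ≤ t₀) :
    derivWithin (tiltMoment ν F V k) (Ici 0) t₀ = tiltMoment ν F V (k + 1) t₀ :=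
  (h.hasDerivWithinAt_tiltMoment k ht₀).derivWithin (uniqueDiffOn_Ici 0 t₀ ht₀)

/-- **Every `N_k` is `C^∞` on `[0, ∞)`.** [folklore] [cite: Balaban1983Higgs3, (1.21) p.416] -/
theorem TiltData.contDiffOn_tiltMoment (h : TiltData ν F V) (k : ℕ) :
    ContDiffOn ℝ ∞ (tiltMoment ν F V k) (Ici 0) := by
  rw [contDiffOn_infty]
  intro m
  induction m generalizing k with
  | zero =>
    exact contDiffOn_zero.2 fun t ht => (h.hasDerivWithinAt_tiltMoment k ht).continuousWithinAt
  | succ m ih =>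
    rw [show ((m + 1 : ℕ) : WithTop ℕ∞) = (m : WithTop ℕ∞) + 1 by push_cast; rfl,
      contDiffOn_succ_iff_derivWithin (uniqueDiffOn_Ici 0)]
    refine ⟨fun t ht => (h.hasDerivWithinAt_tiltMoment k ht).differentiableWithinAt, ?_, ?_⟩
    · intro h'
      exact absurd h' (by simp)
    · exact (ih (k + 1)).congr fun t ht => h.derivWithin_tiltMoment k ht

/-- **The iterated right derivatives of `N_0` are the `N_k`.** [folklore] [cite: Balaban1983Higgs3, (1.21) p.416] -/
theorem TiltData.iteratedDerivWithin_tiltMoment (h : TiltData ν F V) (k : ℕ) :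
    EqOn (iteratedDerivWithin k (tiltMoment ν F V 0) (Ici 0)) (tiltMoment ν F V k) (Ici 0) := by
  induction k with
  | zero => intro t _; rw [iteratedDerivWithin_zero]
  | succ k ih =>
    intro t ht
    rw [iteratedDerivWithin_succ, derivWithin_congr ih (ih ht), h.derivWithin_tiltMoment k ht]

/-! ### The normalized expectation `g(t) = ⟨F e^{−tV}⟩ / ⟨e^{−tV}⟩` -/

/-- The partition function of the tilt: `Z(t) = ∫ e^{−tV} dν` (= `N_0` of the constant observable `1`). [folklore]
[cite: Balaban1983Higgs3, (1.19) p.416] -/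
noncomputable def tiltZ (ν : Measure Ω) (V : Ω → ℝ) (t : ℝ) : ℝ := tiltMoment ν (fun _ => 1) V 0 t

/-- The normalized (Gibbs) expectation of `F` in the tilted measure: `g(t) = ⟨F⟩_t = (∫ F e^{−tV} dν) / (∫ e^{−tV} dν)` —
for the (1.19) data `(ν₀, φ_a(x)φ_b(x′), V)` of the sibling file, `g(1) = G^ε_{ab}(x,x′)`. [folklore] [cite: Balaban1983Higgs3, (1.19) p.416] -/
noncomputable def tiltExpect (ν : Measure Ω) (F V : Ω → ℝ) (t : ℝ) : ℝ := tiltMoment ν F V 0 t / tiltZ ν V t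

/-- `Z(t) = ∫ e^{−tV} dν`. [folklore] [cite: Balaban1983Higgs3, (1.19) p.416] -/
theorem tiltZ_eq_integral (ν : Measure Ω) (V : Ω → ℝ) (t : ℝ) :
    tiltZ ν V t = ∫ σ, Real.exp (-(t * V σ)) ∂ν := by
  unfold tiltZ tiltMoment
  refine integral_congr_ae (Eventually.of_forall fun σ => ?_)
  simp

/-- The constant observable `1` satisfies the hypotheses as soon as all moments of `V` exist. [folklore] [cite: Balaban1983Higgs3, (1.21) p.416] -/
theorem TiltData.one (hV : AEStronglyMeasurable V ν) (hB : ∃ B : ℝ, 0 ≤ B ∧ ∀ σ, -B ≤ V σ)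
    (hint : ∀ k : ℕ, Integrable (fun σ => V σ ^ k) ν) : TiltData ν (fun _ => (1 : ℝ)) V where
  aesm_F := aestronglyMeasurable_const
  aesm_V := hV
  bddBelow := hB
  integrable k := by simpa using hint k

/-- `Z(t) > 0` on `[0, ∞)` for a non-zero measure. [folklore] [cite: Balaban1983Higgs3, (1.19) p.416] -/
theorem TiltData.tiltZ_pos [NeZero ν] (h1 : TiltData ν (fun _ => (1 : ℝ)) V) {t : ℝ} (ht : 0 ≤ t) :
    0 < tiltZ ν V t := by
  rw [tiltZ_eq_integral]
  have hi := h1.integrable_integrand 0 ht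
  simp only [pow_zero, mul_one, one_mul] at hi
  exact integral_exp_pos hi

/-- `Z` is `C^∞` on `[0, ∞)`. [folklore] [cite: Balaban1983Higgs3, (1.21) p.416] -/
theorem TiltData.contDiffOn_tiltZ (h1 : TiltData ν (fun _ => (1 : ℝ)) V) : ContDiffOn ℝ ∞ (tiltZ ν V) (Ici 0) :=
  h1.contDiffOn_tiltMoment 0

/-- **The tilted Gibbs expectation `g` is `C^∞` on `[0, ∞)`.** [folklore] [cite: Balaban1983Higgs3, (1.21) p.416] -/
theorem TiltData.contDiffOn_tiltExpect [NeZero ν] (h : TiltData ν F V) (h1 : TiltData ν (fun _ => (1 : ℝ)) V) :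
    ContDiffOn ℝ ∞ (tiltExpect ν F V) (Ici 0) :=
  (h.contDiffOn_tiltMoment 0).div h1.contDiffOn_tiltZ fun _ ht => (h1.tiltZ_pos ht).ne'

end Tilted


/-! ## §3 The perturbative coefficients: `g^{(n)}(t) = ⟨F; −V; …; −V⟩ᵀ_t` and Taylor's formula at `0⁺` -/

section Coefficients

open Set

variable {Ω : Type*} [MeasurableSpace Ω] {ν : Measure Ω} {F V : Ω → ℝ} {β : Type*} [DecidableEq β]

/-- Transport of `iteratedDerivWithin` along sets that agree near the point. [folklore] -/
private theorem iteratedDerivWithin_congr_set {s u : Set ℝ} {x : ℝ} (hsu : s =ᶠ[𝓝 x] u) (n : ℕ) (f : ℝ → ℝ) :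
    iteratedDerivWithin n f s x = iteratedDerivWithin n f u x := by
  rw [iteratedDerivWithin, iteratedDerivWithin, iteratedFDerivWithin_congr_set hsu]

/-- The pinned derivative moments of `(N^F_0, Z)` at `t ≥ 0` ARE the normalized tilted expectations
`⟨F(−V)^{|K|−1}⟩_t` (pin in `K`) resp. `⟨(−V)^{|K|}⟩_t` (pin not in `K`). [folklore] [cite: Mastropietro2008, §2.3 (2.36)-(2.38)] -/
theorem TiltData.pinnedMoments_eq (h : TiltData ν F V) (h1 : TiltData ν (fun _ => (1 : ℝ)) V) {t : ℝ}
    (ht : 0 ≤ t) (j : β) (K : Finset β) :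
    pinnedMoments j (tiltMoment ν F V 0) (tiltZ ν V) (Ici 0) t K
      = if j ∈ K then tiltMoment ν F V (K.card - 1) t / tiltZ ν V t
        else tiltMoment ν (fun _ => (1 : ℝ)) V K.card t / tiltZ ν V t := by
  unfold pinnedMoments
  split_ifs with hj
  · rw [h.iteratedDerivWithin_tiltMoment _ ht]
  · rw [show tiltZ ν V = tiltMoment ν (fun _ => (1 : ℝ)) V 0 from rfl, h1.iteratedDerivWithin_tiltMoment _ ht]

/-- **The `t`-derivatives of the tilted Gibbs expectation to all orders are the PINNED TRUNCATED EXPECTATIONS.**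
For `t ≥ 0`, a pin `j ∉ W`:
`(d/dt)^{|W|} g(t) = ursellOf (pinned tilted moments at t) (insert j W) = ⟨F; −V; …; −V⟩ᵀ_t` (`|W|` insertions of `−V`),
the derivatives being right derivatives within `[0, ∞)` — «the expansion of G^ε» at the level of coefficients: only
CONNECTED (truncated) expectations occur, the disconnected parts having cancelled against `Z`. [folklore]
[cite: Balaban1983Higgs3, (1.21) p.416] [cite: Mastropietro2008, §2.3 (2.32)-(2.38)] -/
theorem TiltData.iteratedDerivWithin_tiltExpect_eq_ursellOf [NeZero ν] (h : TiltData ν F V)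
    (h1 : TiltData ν (fun _ => (1 : ℝ)) V) {t : ℝ} (ht : 0 ≤ t) {j : β} {W : Finset β} (hjW : j ∉ W) :
    iteratedDerivWithin W.card (tiltExpect ν F V) (Ici 0) t
      = ursellOf (pinnedMoments j (tiltMoment ν F V 0) (tiltZ ν V) (Ici 0) t) (insert j W) := by
  have hz : ContDiffOn ℝ (W.card : ℕ) (tiltZ ν V) (Ici 0) := h1.contDiffOn_tiltZ.of_le (by exact_mod_cast le_top)
  have hw : ContDiffOn ℝ (W.card : ℕ) (tiltMoment ν F V 0) (Ici 0) :=
    (h.contDiffOn_tiltMoment 0).of_le (by exact_mod_cast le_top)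
  exact iteratedDerivWithin_div_eq_ursellOf (uniqueDiffOn_Ici 0) ht hz hw
    (fun x hx => h1.tiltZ_pos hx) hjW le_rfl

/-- The same with `n` insertions labelled by `Fin n` (pin = `none : Option (Fin n)`). [folklore] [cite: Balaban1983Higgs3, (1.21) p.416]
[cite: Mastropietro2008, §2.3 (2.32)-(2.38)] -/
theorem TiltData.iteratedDerivWithin_tiltExpect_eq_ursellOf_fin [NeZero ν] (h : TiltData ν F V)
    (h1 : TiltData ν (fun _ => (1 : ℝ)) V) {t : ℝ} (ht : 0 ≤ t) (n : ℕ) :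
    iteratedDerivWithin n (tiltExpect ν F V) (Ici 0) t
      = ursellOf (pinnedMoments (none : Option (Fin n)) (tiltMoment ν F V 0) (tiltZ ν V) (Ici 0) t)
          (insert none ((univ : Finset (Fin n)).map Function.Embedding.some)) := by
  have hcard : ((univ : Finset (Fin n)).map Function.Embedding.some).card = n := by simp
  have hnot : (none : Option (Fin n)) ∉ (univ : Finset (Fin n)).map Function.Embedding.some := by simp
  rw [← h.iteratedDerivWithin_tiltExpect_eq_ursellOf h1 ht hnot, hcard]

/-- **Explicit Möbius form**: `g^{(|W|)}(t) = Σ_{π ∈ 𝒫(W ∪ {j})} (−1)^{|π|−1}(|π|−1)! Π_{B∈π} ⟨…⟩_t`. [folklore]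
[cite: Balaban1983Higgs3, (1.21) p.416] [cite: Ruelle1969, §4.4.1 (4.6)] -/
theorem TiltData.iteratedDerivWithin_tiltExpect_eq_sum_setPartitions [NeZero ν] (h : TiltData ν F V)
    (h1 : TiltData ν (fun _ => (1 : ℝ)) V) {t : ℝ} (ht : 0 ≤ t) {j : β} {W : Finset β} (hjW : j ∉ W) :
    iteratedDerivWithin W.card (tiltExpect ν F V) (Ici 0) t
      = ∑ π ∈ setPartitions (insert j W), (-1 : ℝ) ^ (π.card - 1) * ((π.card - 1).factorial : ℝ)
          * ∏ K ∈ π, pinnedMoments j (tiltMoment ν F V 0) (tiltZ ν V) (Ici 0) t K := by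
  have hz : ContDiffOn ℝ (W.card : ℕ) (tiltZ ν V) (Ici 0) := h1.contDiffOn_tiltZ.of_le (by exact_mod_cast le_top)
  have hw : ContDiffOn ℝ (W.card : ℕ) (tiltMoment ν F V 0) (Ici 0) :=
    (h.contDiffOn_tiltMoment 0).of_le (by exact_mod_cast le_top)
  exact iteratedDerivWithin_div_eq_sum_setPartitions (uniqueDiffOn_Ici 0) ht hz hw
    (fun x hx => h1.tiltZ_pos hx) hjW le_rfl

/-- First order: `g′(t) = ⟨F(−V)⟩_t − ⟨F⟩_t⟨−V⟩_t` (minus the covariance of `F` and `V` in the tilted state).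
[folklore] [cite: Balaban1983Higgs3, (1.21) p.416] -/
theorem TiltData.derivWithin_tiltExpect [NeZero ν] (h : TiltData ν F V) (h1 : TiltData ν (fun _ => (1 : ℝ)) V)
    {t : ℝ} (ht : 0 ≤ t) :
    derivWithin (tiltExpect ν F V) (Ici 0) t
      = tiltMoment ν F V 1 t / tiltZ ν V t
        - tiltMoment ν F V 0 t / tiltZ ν V t * (tiltMoment ν (fun _ => (1 : ℝ)) V 1 t / tiltZ ν V t) := by
  have hmain := h.iteratedDerivWithin_tiltExpect_eq_ursellOf h1 ht
    (j := (none : Option Unit)) (W := {some ()}) (by simp)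
  rw [Finset.card_singleton, iteratedDerivWithin_one] at hmain
  rw [hmain, show insert (none : Option Unit) ({some ()} : Finset (Option Unit)) = {none, some ()} from rfl,
    ursellOf_pair _ (pinnedMoments_empty _ _ _ _ (h1.tiltZ_pos ht).ne') (by simp),
    h.pinnedMoments_eq h1 ht, h.pinnedMoments_eq h1 ht, h.pinnedMoments_eq h1 ht]
  simp

/-- **Taylor's formula at `t = 0⁺` with Lagrange remainder** — «the function has a perturbative expansion»:
for every order `n` and every `t > 0` there is `ξ ∈ (0, t)` with
`g(t) = Σ_{k ≤ n} g^{(k)}(0⁺) t^k / k! + g^{(n+1)}(ξ) t^{n+1} / (n+1)!`, all derivatives within `[0, ∞)`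
(so by the previous theorems: the coefficients are the truncated expectations `⟨F; −V; …; −V⟩ᵀ_0 / k!` of the
UNPERTURBED measure and the remainder is a truncated expectation of the tilted measure at `ξ`). [folklore]
[cite: Balaban1983Higgs3, (1.21) p.416] -/
theorem TiltData.taylor_tiltExpect [NeZero ν] (h : TiltData ν F V) (h1 : TiltData ν (fun _ => (1 : ℝ)) V)
    (n : ℕ) {t : ℝ} (ht : 0 < t) :
    ∃ ξ ∈ Ioo 0 t, tiltExpect ν F V t
      = ∑ k ∈ Finset.range (n + 1), iteratedDerivWithin k (tiltExpect ν F V) (Ici 0) 0 * t ^ k / (k.factorial : ℝ)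
        + iteratedDerivWithin (n + 1) (tiltExpect ν F V) (Ici 0) ξ * t ^ (n + 1) / ((n + 1).factorial : ℝ) := by
  set g := tiltExpect ν F V with hgdef
  have hg : ContDiffOn ℝ ∞ g (Ici 0) := h.contDiffOn_tiltExpect h1
  have hIcc : uIcc 0 t = Icc 0 t := uIcc_of_le ht.le
  have hIoo : uIoo 0 t = Ioo 0 t := uIoo_of_le ht.le
  have hsub : Icc 0 t ⊆ Ici 0 := fun x hx => hx.1
  have hgn1 : ContDiffOn ℝ ((n + 1 : ℕ) : WithTop ℕ∞) g (Icc 0 t) := (hg.of_le (by exact_mod_cast le_top)).mono hsub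
  have hgn : ContDiffOn ℝ n g (uIcc 0 t) := by
    rw [hIcc]; exact hgn1.of_le (by exact_mod_cast Nat.le_succ n)
  have hdiff : DifferentiableOn ℝ (iteratedDerivWithin n g (uIcc 0 t)) (uIoo 0 t) := by
    rw [hIcc, hIoo]
    exact (hgn1.differentiableOn_iteratedDerivWithin (by exact_mod_cast Nat.lt_succ_self n)
      (uniqueDiffOn_Icc ht)).mono Ioo_subset_Icc_self
  obtain ⟨ξ, hξ, hrem⟩ := taylor_mean_remainder_lagrange ht.ne hgn hdiff
  rw [hIoo] at hξ
  rw [hIcc, taylor_within_apply] at hrem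
  refine ⟨ξ, hξ, ?_⟩
  have hset0 : (Icc 0 t : Set ℝ) =ᶠ[𝓝 (0 : ℝ)] (Ici 0 : Set ℝ) := by
    rw [Filter.eventuallyEq_set]
    filter_upwards [Iio_mem_nhds ht] with y hy
    exact ⟨fun hy' => hy'.1, fun hy' => ⟨hy', (mem_Iio.1 hy).le⟩⟩
  have hsetξ : (Icc 0 t : Set ℝ) =ᶠ[𝓝 ξ] (Ici 0 : Set ℝ) := by
    rw [Filter.eventuallyEq_set]
    filter_upwards [Ioo_mem_nhds hξ.1 hξ.2] with y hy
    exact ⟨fun hy' => hy'.1, fun hy' => ⟨hy', hy.2.le⟩⟩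
  have hsum : ∑ k ∈ Finset.range (n + 1), ((k.factorial : ℝ)⁻¹ * (t - 0) ^ k) • iteratedDerivWithin k g (Icc 0 t) 0
      = ∑ k ∈ Finset.range (n + 1), iteratedDerivWithin k g (Ici 0) 0 * t ^ k / (k.factorial : ℝ) := by
    refine sum_congr rfl fun k _ => ?_
    rw [iteratedDerivWithin_congr_set hset0, smul_eq_mul, sub_zero]
    ring
  rw [hsum, iteratedDerivWithin_congr_set hsetξ, sub_zero] at hrem
  linarith
  
end Coefficients


end Literature.MathematicalPhysics.QuantumFieldTheory.Balaban1983to89.B3TwoPointPerturbativeCoefficients
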